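import Summits.HodgeConjecture.HodgeConjecture.Theorems.VHCAbelianSchemesRoadIsogenyDerivedAdjointPairOfRouteKApi
import Summits.HodgeConjecture.HodgeConjecture.Theorems.VHCAbelianSchemesRoadKappaCommShift
import HarnessLib

/-!
# Road №4 (`VHCAbelianSchemesRoad`) — (Tr)Pair of THEOREM T′ (crux stmt-HodgeConjecture-26512): **(N3′) PROVED for the route-K
# node `P₀`** — `g_{**}` commutes with `Φ = shiftedHomMap 𝓗om•(E, –)` up to `κ• = homComplexPushforwardComparison`

research route conditional on HC_CM; not a corollary; Q11.4-sentence-2 already refuted in dim ≥ 3.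

Seat core-w1 ((TrPair) owner; director-hodge g16 R16.21 (1) «(N3′) ⟸ route K naturality», R16.24 card rev 19 «(c1Tr) ⟸ {Θ + (T2•),
(N3′) [w7 Api ✓ → w1], injectivity of ρ_q [w1]}»). `--supports stmt-HodgeConjecture-26512 --as helper`; closes NO stub or item;
nothing here says (Tr)Pair, (SC), (c1), THEOREM T′, `HC_AV`, `HC_CM` or HC holds; HC_CM HELD, by name only.

THE THEOREM (`mapShiftedHom_routeK_shiftedHomMap_comp_kappa`, general form; `mapShiftedHom_phi_comp_routeK`, the field (N3′) of
core-w2's `TracePushforwardBricks` ∕ the hypothesis `hN3` of core-w1's `tracePushforwardCompatPair_of_residual`, VERBATIM, for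
`P := isogenyDerivedAdjointPairOfRouteK`): for an isogeny `g : A → A`, `E•` in `[a, b]` with vector-bundle terms, bounded vector-bundle
complexes `K•, L•` and a derived class `y : Q K ⟶ (Q L)⟦n⟧`,

  `g_{**}(Φ_E y) ≫ (Q κ_{E,L})⟦n⟧' = Q κ_{E,K} ≫ Φ_{g_*•E}(g_{**} y)`,

where `g_{**} = (P₀ A g hg).mapShiftedHom` is the route-K node's action on derived classes (core-w7∕w4), `Φ_E = shiftedHomMap 𝓗om•(E, –)`
is the venture's descended internal Hom, and `κ_{E,M} : g_*•𝓗om•(E, M) ⟶ 𝓗om•(g_*•E, g_*•M)` is the comparison of record (`kappaData`).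

PROOF (all in the kernel; [cite: Lipman2009, Prop. 3.2.3] for `g_{**}` on K-injective representatives, [cite: Weibel1994, §10.4 and
Cor. 10.4.7] for the localisation calculus, [cite: Hartshorne1977, III Prop. 8.1 and III.6.3/6.7] for the acyclicity inputs):
1. (`…KappaCommShift` §3) `κ` IS A SHIFT-COMPATIBLE NATURAL TRANSFORMATION `𝓗om•(E, –) ⋙ g_*• ⟶ g_*• ⋙ 𝓗om•(g_*•E, –)` (`kappaNatTrans`, Mathlib
   `NatTrans.CommShift`; summand by summand every shift isomorphism involved is an identity — the template is core-SC's
   `homFunctorPushforwardIso_hom_commShift` for scheme isomorphisms), hence (Mathlib `ShiftedHom.map_naturality`) the CHAIN-LEVEL square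
   `g_*•(w̃ ⋅ 𝓗om•(E,–)) ≫ κ_I⟦n⟧' = κ_K ≫ (g_*• w̃) ⋅ 𝓗om•(g_*•E, –)` for every chain map `w̃ : K ⟶ I⟦n⟧`.
2. (`…KappaCommShift` §1) `Φ` of the class of a chain map is the class of `𝓗om•(E, w̃)` (`shiftedHomMap_map_Q`: the factorisation `Q ⋙ Φ^D ≅ Φ ⋙ Q`
   commutes with shifts, Mathlib `NatTrans.commShift_iso_hom_of_localization`), and `Φ(x ≫ (Q φ)⟦n⟧') = Φ x ≫ (Q 𝓗om•(E, φ))⟦n⟧'`.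
3. (§1 here) By core-w7's `exists_representative_routeK` ∕ `mapShiftedHom_isogenyDerivedAdjointPairOfRouteK_eq`, `y ≫ (Q ι)⟦n⟧'` is the class
   of a chain map `w̃ : K ⟶ I⟦n⟧` for the chosen route-K resolution `ι : L → I`, and `g_{**} y = [g_*• w̃] ≫ (Q g_*•ι)⁻¹⟦n⟧'`. The NEW
   POINT: `𝓗om•(E, ι) ≫ θ : 𝓗om•(E, L) → 𝓗om•(E, I) → J` (`θ` any injective resolution of `𝓗om•(E, I)`) is AGAIN a route-K resolution —
   `𝓗om•(E, –)` preserves quasi-isomorphisms (venture `homFunctor_map_quasiIso`) and `g_*(𝓗om•(E, ι) ≫ θ)` is a quasi-isomorphism by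
   Leray (`quasiIso_pushforward_map_of_injective_of_isAffineLocalizing`) — and `Φ_E y ≫ Q(𝓗om•(E, ι) ≫ θ)⟦n⟧'` is the class of the
   chain map `𝓗om•(E, w̃) ≫ θ⟦n⟧'`, so `g_{**}(Φ_E y)` is computed by the same formula.
4. (`…KappaCommShift` §2) To cancel `θ`: **the terms of `𝓗om•(E•, I•)` are `g_*`-ACYCLIC** for `I•` termwise injective (`𝓗om(E^i, I^j)` is FLASQUE —
   the tree's `isFlasque_sheafHom` [Godement II 3.1.2] with `isFlasque_of_injective_modules` — hence acyclic on every open; finite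
   coproducts of `g_*`-acyclics are `g_*`-acyclic, Mathlib `ObjectProperty.IsClosedUnderFiniteProducts`), so `g_*• θ` is a
   quasi-isomorphism (`quasiIso_pushforward_map_of_isPushforwardAcyclic`); the rest is the naturality of `κ` at `ι` and step 1.

COROLLARY (§2 here, `tracePushforwardBricksRouteK`, `tracePushforwardCompatPair_routeK_of_residual`): for `P₀` the bricks need only a trace
family `Θ` with (T2•) — the `𝓗om•`-boundedness witnesses are core-w2's `isBoundedVBComplex_hom₀_of_strictly ∕ _hom_twist_of_strictly`
(p653143), (T1•) is core-w1's theorem (p652970), (N3′) is this file — and (Tr)Pair for `P₀` follows from {Θ + (T2•), injectivity of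
`ρ_q`}: the displayed residual of (c1Tr) is DOWN TO TWO inputs. Nothing else assumed; no named fact; no `sorry`.
-/

noncomputable section

-- `TopCat.Presheaf`/`Scheme.Modules`/`GradedObject` are not reducible (as in Mathlib's `AlgebraicGeometry/Modules/Sheaf.lean`).
set_option backward.isDefEq.respectTransparency false

open CategoryTheory CategoryTheory.Category CategoryTheory.Limits AlgebraicGeometry Opposite
open DerivedCategory

namespace Summit.HodgeConjecture.HodgeConjecture.Ring2.SemiregularRepresentatives

set_option linter.dupNamespace false -- the cell's namespace repeats the summit name, as in every `Ring2*` file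

open Literature.AlgebraicGeometry Literature.AlgebraicGeometry.Modules Literature.AlgebraicGeometry.Motives
open Literature.AlgebraicGeometry.Motives.AbelianVariety Literature.AlgebraicGeometry.KTheory Literature.Algebra.Homology
open Summit.Ventures.HSemireg Summit.Ventures.HSemireg.HomComplex

/-! ## §1 (N3′) for the route-K node `P₀` -/

section N3

variable {A : AbelianVariety ℂ} {g : A ⟶ A} (hg : IsIsogeny g)

set_option maxHeartbeats 400000 in
-- one long computation in `D(Mod 𝒪_A)`: two resolutions, two representatives, four quasi-isomorphisms to cancel
/-- **(N3′) for `P₀`, general form: `g_{**}(Φ_E y) ≫ (Q κ_{E,L})⟦n⟧' = Q κ_{E,K} ≫ Φ_{g_*•E}(g_{**} y)`** for every derived class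
`y : Q K ⟶ (Q L)⟦n⟧` between bounded vector-bundle complexes, `E•` in `[a, b]` with vector-bundle terms (and `g_*•E•` with vector-bundle
terms). See the module docstring for the proof. [cite: Lipman2009, Prop. 3.2.3] [cite: Weibel1994, §10.4 and Cor. 10.4.7]
[cite: Hartshorne1977, III Prop. 6.7 (proof) and III Prop. 8.1] -/
theorem mapShiftedHom_routeK_shiftedHomMap_comp_kappa (E : CochainComplex A.X.left.Modules ℤ) (a b : ℤ)
    [E.IsStrictlyGE a] [E.IsStrictlyLE b] (hE : ∀ i, IsFiniteLocallyFree (E.X i))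
    (hE' : ∀ i, IsFiniteLocallyFree ((endoPushforwardComplex A g E).X i))
    {K L : CochainComplex A.X.left.Modules ℤ} (hK : IsBoundedVBComplex K) (hL : IsBoundedVBComplex L)
    (hHK : IsBoundedVBComplex ((homFunctor A.X.left E).obj K)) (hHL : IsBoundedVBComplex ((homFunctor A.X.left E).obj L))
    {n : ℤ} (y : letI := HasDerivedCategory.standard A.X.left.Modules; ShiftedHom (Q.obj K) (Q.obj L) n) :
    letI := HasDerivedCategory.standard A.X.left.Modules
    (isogenyDerivedAdjointPairOfRouteK A g hg).mapShiftedHom hHK hHL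
        (shiftedHomMap (homFunctor A.X.left E) (homFunctor_isInvertedBy A.X E a b hE) y) ≫
      (Q.map (kappaData A g E L a b))⟦n⟧' =
    Q.map (kappaData A g E K a b) ≫
      shiftedHomMap (homFunctor A.X.left (endoPushforwardComplex A g E))
        (homFunctor_isInvertedBy A.X (endoPushforwardComplex A g E) a b hE')
        ((isogenyDerivedAdjointPairOfRouteK A g hg).mapShiftedHom hK hL y) := by
  letI := HasDerivedCategory.standard A.X.left.Modules
  haveI : IsFinite (Hom.toSchemeHom g) := hg.2
  -- Step 1: a route-K resolution `ι : L → I` and a representative `w̃ : K → I⟦n⟧` of `y`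
  let r := routeKResolution hg hL
  haveI := r.quasiIso
  haveI := r.isStrictlyGE
  obtain ⟨w, hw⟩ := exists_representative_routeK r n y
  -- Step 2: an injective resolution `θ : 𝓗om•(E, I) → J`
  haveI : ((homFunctor A.X.left E).obj r.I).IsStrictlyGE (r.a - b) := HomComplex.isStrictlyGE A.X.left E r.I b r.a
  obtain ⟨J, θ, hθ, hJ, hJa⟩ :=
    CochainComplex.Plus.modelCategoryQuillen.exists_quasiIso_injective ((homFunctor A.X.left E).obj r.I) (r.a - b)
  haveI := hθ
  haveI := hJa
  -- lower bounds
  obtain ⟨c, hc⟩ := exists_isZero_of_lt_of_isBoundedVBComplex hL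
  haveI : L.IsStrictlyGE c := (CochainComplex.isStrictlyGE_iff L c).2 (fun i hi => hc i hi)
  haveI : ((homFunctor A.X.left E).obj L).IsStrictlyGE (c - b) := HomComplex.isStrictlyGE A.X.left E L b c
  haveI : ((homFunctor A.X.left E).obj L).IsStrictlyGE (min c r.a - b) :=
    CochainComplex.isStrictlyGE_of_ge _ _ (c - b) (by omega)
  haveI : J.IsStrictlyGE (min c r.a - b) := CochainComplex.isStrictlyGE_of_ge _ _ (r.a - b) (by omega)
  -- Step 3: `g_*•θ` and `g_*•(𝓗om•(E, ι) ≫ θ)` are quasi-isomorphisms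
  haveI hGθ : QuasiIso (((Scheme.Modules.pushforward (Hom.toSchemeHom g)).mapHomologicalComplex (ComplexShape.up ℤ)).map θ) :=
    quasiIso_pushforward_map_of_isPushforwardAcyclic (Hom.toSchemeHom g) θ (r.a - b)
      (fun m => isPushforwardAcyclic_homComplex_X_of_injective _ E r.I a b hE r.injective m)
      (fun m => by haveI := hJ m; exact IsPushforwardAcyclic.of_injective _ (J.X m))
  haveI : QuasiIso ((homFunctor A.X.left E).map r.ι) := homFunctor_map_quasiIso A.X E a b hE r.ι r.quasiIso
  haveI hGιθ : QuasiIso (((Scheme.Modules.pushforward (Hom.toSchemeHom g)).mapHomologicalComplex (ComplexShape.up ℤ)).map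
      ((homFunctor A.X.left E).map r.ι ≫ θ)) :=
    quasiIso_pushforward_map_of_injective_of_isAffineLocalizing (Hom.toSchemeHom g) ((homFunctor A.X.left E).map r.ι ≫ θ)
      (min c r.a - b) (fun m => by
        haveI := (hHL.isFiniteLocallyFree m).isVectorBundle.1
        exact IsAffineLocalizing.of_isQuasicoherent _) (hI := hJ)
  -- Step 4: the induced route-K resolution of `𝓗om•(E, L)` and the representative of `Φ_E y`
  let rH : RouteKResolution A g ((homFunctor A.X.left E).obj L) :=
    ⟨J, (homFunctor A.X.left E).map r.ι ≫ θ, min c r.a - b, inferInstance, hJ, inferInstance, hGιθ⟩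
  have hwH : (shiftedHomMap (homFunctor A.X.left E) (homFunctor_isInvertedBy A.X E a b hE) y ≫ (Q.map rH.ι)⟦n⟧' :
        ShiftedHom (Q.obj ((homFunctor A.X.left E).obj K)) (Q.obj rH.I) n) =
      ShiftedHom.map ((w.map (homFunctor A.X.left E)) ≫ θ⟦n⟧' : ShiftedHom ((homFunctor A.X.left E).obj K) J n) Q := by
    change shiftedHomMap (homFunctor A.X.left E) (homFunctor_isInvertedBy A.X E a b hE) y ≫
        (Q.map ((homFunctor A.X.left E).map r.ι ≫ θ))⟦n⟧' = _
    rw [Functor.map_comp, Functor.map_comp, ← Category.assoc, ← shiftedHomMap_comp_shift_map_Q, hw, shiftedHomMap_map_Q,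
      shiftedHom_map_comp_shift_map]
  -- Step 5: `g_{**}` on both classes via their representatives (core-w7's API)
  rw [mapShiftedHom_isogenyDerivedAdjointPairOfRouteK_eq hg hHK hHL rH _ _ hwH,
    mapShiftedHom_isogenyDerivedAdjointPairOfRouteK_eq hg hK hL r y w hw]
  -- Step 6: cancel the quasi-isomorphism `𝓗om•(g_*•E, g_*•ι)` on the right
  haveI hιiso : IsIso (Q.map ((homFunctor A.X.left (endoPushforwardComplex A g E)).map
      (((Scheme.Modules.pushforward (Hom.toSchemeHom g)).mapHomologicalComplex (ComplexShape.up ℤ)).map r.ι))) := by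
    rw [DerivedCategory.isIso_Q_map_iff_quasiIso]
    exact homFunctor_map_quasiIso A.X (endoPushforwardComplex A g E) a b hE' _ r.quasiIso_pushforward
  rw [← cancel_mono ((Q.map ((homFunctor A.X.left (endoPushforwardComplex A g E)).map
      (((Scheme.Modules.pushforward (Hom.toSchemeHom g)).mapHomologicalComplex (ComplexShape.up ℤ)).map r.ι)))⟦n⟧')]
  -- the right-hand side becomes `Q κ_K ≫ [(g_*• w̃) ⋅ 𝓗om•(g_*•E, –)]`
  haveI : IsIso (Q.map (((Scheme.Modules.pushforward (Hom.toSchemeHom g)).mapHomologicalComplex (ComplexShape.up ℤ)).map r.ι)) := by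
    rw [DerivedCategory.isIso_Q_map_iff_quasiIso]; exact r.quasiIso_pushforward
  have hR : shiftedHomMap (homFunctor A.X.left (endoPushforwardComplex A g E))
        (homFunctor_isInvertedBy A.X (endoPushforwardComplex A g E) a b hE')
        ((w.map ((Scheme.Modules.pushforward (Hom.toSchemeHom g)).mapHomologicalComplex (ComplexShape.up ℤ))).map Q ≫
          (inv (Q.map (((Scheme.Modules.pushforward (Hom.toSchemeHom g)).mapHomologicalComplex (ComplexShape.up ℤ)).map
            r.ι)))⟦n⟧') ≫
        (Q.map ((homFunctor A.X.left (endoPushforwardComplex A g E)).map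
          (((Scheme.Modules.pushforward (Hom.toSchemeHom g)).mapHomologicalComplex (ComplexShape.up ℤ)).map r.ι)))⟦n⟧' =
      ((w.map ((Scheme.Modules.pushforward (Hom.toSchemeHom g)).mapHomologicalComplex (ComplexShape.up ℤ))).map
        (homFunctor A.X.left (endoPushforwardComplex A g E))).map Q := by
    rw [← shiftedHomMap_comp_shift_map_Q, Category.assoc, ← Functor.map_comp, IsIso.inv_hom_id,
      CategoryTheory.Functor.map_id, Category.comp_id, shiftedHomMap_map_Q]
  -- naturality of `κ` at `ι`, after `Q` and the shift
  have hnat := (kappaNatTrans A g E a b).naturality r.ι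
  simp only [Functor.comp_map, kappaNatTrans_app] at hnat
  have hL1 : (Q.map (kappaData A g E L a b))⟦n⟧' ≫
        (Q.map ((homFunctor A.X.left (endoPushforwardComplex A g E)).map
          (((Scheme.Modules.pushforward (Hom.toSchemeHom g)).mapHomologicalComplex (ComplexShape.up ℤ)).map r.ι)))⟦n⟧' =
      (Q.map (((Scheme.Modules.pushforward (Hom.toSchemeHom g)).mapHomologicalComplex (ComplexShape.up ℤ)).map
          ((homFunctor A.X.left E).map r.ι)))⟦n⟧' ≫ (Q.map (kappaData A g E r.I a b))⟦n⟧' := by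
    rw [← Functor.map_comp, ← Functor.map_comp, ← Functor.map_comp, ← Functor.map_comp, hnat]
  -- `e₃ ≫ e₂⁻¹ ≫ Q(g_*• 𝓗om•(E, ι)) = 𝟙` where `e₂ = Q(g_*•(𝓗om•(E, ι) ≫ θ))`, `e₃ = Q(g_*• θ)`
  haveI : IsIso (Q.map (((Scheme.Modules.pushforward (Hom.toSchemeHom g)).mapHomologicalComplex (ComplexShape.up ℤ)).map θ)) := by
    rw [DerivedCategory.isIso_Q_map_iff_quasiIso]; exact hGθ
  haveI : IsIso (Q.map (((Scheme.Modules.pushforward (Hom.toSchemeHom g)).mapHomologicalComplex (ComplexShape.up ℤ)).map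
      ((homFunctor A.X.left E).map r.ι ≫ θ))) := by
    rw [DerivedCategory.isIso_Q_map_iff_quasiIso]; exact hGιθ
  have hsplit : Q.map (((Scheme.Modules.pushforward (Hom.toSchemeHom g)).mapHomologicalComplex (ComplexShape.up ℤ)).map
        ((homFunctor A.X.left E).map r.ι)) =
      Q.map (((Scheme.Modules.pushforward (Hom.toSchemeHom g)).mapHomologicalComplex (ComplexShape.up ℤ)).map
          ((homFunctor A.X.left E).map r.ι ≫ θ)) ≫
        inv (Q.map (((Scheme.Modules.pushforward (Hom.toSchemeHom g)).mapHomologicalComplex (ComplexShape.up ℤ)).map θ)) := by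
    rw [Functor.map_comp, Functor.map_comp, Category.assoc, IsIso.hom_inv_id, Category.comp_id]
  have hL4 : (Q.map (((Scheme.Modules.pushforward (Hom.toSchemeHom g)).mapHomologicalComplex (ComplexShape.up ℤ)).map θ))⟦n⟧' ≫
        (inv (Q.map (((Scheme.Modules.pushforward (Hom.toSchemeHom g)).mapHomologicalComplex (ComplexShape.up ℤ)).map
          rH.ι)))⟦n⟧' ≫
          (Q.map (((Scheme.Modules.pushforward (Hom.toSchemeHom g)).mapHomologicalComplex (ComplexShape.up ℤ)).map
            ((homFunctor A.X.left E).map r.ι)))⟦n⟧' = 𝟙 _ := by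
    change _ ≫ (inv (Q.map (((Scheme.Modules.pushforward (Hom.toSchemeHom g)).mapHomologicalComplex (ComplexShape.up ℤ)).map
      ((homFunctor A.X.left E).map r.ι ≫ θ))))⟦n⟧' ≫ _ = _
    rw [← Functor.map_comp, ← Functor.map_comp, hsplit, IsIso.inv_hom_id_assoc, IsIso.hom_inv_id,
      CategoryTheory.Functor.map_id]
  -- the chain-level square: `κ` is a shift-compatible natural transformation (`kappaNatTrans_commShift`)
  haveI := kappaNatTrans_commShift A g E a b
  have hD := ShiftedHom.map_naturality w (kappaNatTrans A g E a b)
  rw [ShiftedHom.comp_mk₀, ShiftedHom.mk₀_comp, ShiftedHom.comp_map, ShiftedHom.comp_map, kappaNatTrans_app,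
    kappaNatTrans_app] at hD
  -- assemble
  simp only [Category.assoc]
  rw [hR, hL1, shiftedHom_map_comp_shift_map, shiftedHom_map_comp_shift_map, Category.assoc, reassoc_of% hL4,
    ← shiftedHom_map_comp_shift_map, ← shiftedHom_map_precomp, hD]

/-- **(N3′) FOR `P₀` — the field `mapShiftedHom_phi_comp` of `TracePushforwardBricks` ∕ the hypothesis `hN3` of
`tracePushforwardCompatPair_of_residual`, VERBATIM, for `P := isogenyDerivedAdjointPairOfRouteK`** (`K := E`, `L := E ⊗ Ω^q`, `n := q + 2`).
[cite: Lipman2009, Prop. 3.2.3] [cite: Weibel1994, §10.4 and Cor. 10.4.7] [cite: BuchweitzFlenner2003, Def. 4.1] -/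
theorem mapShiftedHom_phi_comp_routeK (E : CochainComplex A.X.left.Modules ℤ) (a b : ℤ) [E.IsStrictlyGE a] [E.IsStrictlyLE b]
    (hE : ∀ i, IsFiniteLocallyFree (E.X i)) (hE' : ∀ i, IsFiniteLocallyFree ((endoPushforwardComplex A g E).X i)) (q : ℕ)
    (hH₀ : IsBoundedVBComplex ((homFunctor A.X.left E).obj E))
    (hH' : IsBoundedVBComplex ((homFunctor A.X.left E).obj (twistHodgeComplex A.X q E))) :
    letI := HasDerivedCategory.standard A.X.left.Modules
    ∀ y : ShiftedHom (Q.obj E) (Q.obj (twistHodgeComplex A.X q E)) ((q : ℤ) + 2),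
      (isogenyDerivedAdjointPairOfRouteK A g hg).mapShiftedHom hH₀ hH'
          (shiftedHomMap (homFunctor A.X.left E) (homFunctor_isInvertedBy A.X E a b hE) y) ≫
          (Q.map (kappaData A g E (twistHodgeComplex A.X q E) a b))⟦(q : ℤ) + 2⟧' =
        Q.map (kappaData A g E E a b) ≫
          shiftedHomMap (homFunctor A.X.left (endoPushforwardComplex A g E))
            (homFunctor_isInvertedBy A.X (endoPushforwardComplex A g E) a b hE')
            ((isogenyDerivedAdjointPairOfRouteK A g hg).mapShiftedHom (isBoundedVBComplex_of_strictly E a b hE)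
              (isBoundedVBComplex_twistHodgeComplex A (isBoundedVBComplex_of_strictly E a b hE) q) y) :=
  fun y => mapShiftedHom_routeK_shiftedHomMap_comp_kappa hg E a b hE hE' _ _ hH₀ hH' y

end N3

/-! ## §2 The residual of (Tr)Pair for `P₀` after (N3′): a trace family `Θ` with (T2•), and the injectivity of `ρ_q` -/

section Residual

variable {A : AbelianVariety ℂ} {g : A ⟶ A} (hg : IsIsogeny g)

/-- **`TracePushforwardBricks` FOR `P₀` FROM `Θ` AND (T2•) ALONE**: `κ₀, κ := kappaData`, `η := etaData` ((T1•) = core-w1's theorem),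
the `𝓗om•`-boundedness witnesses = core-w2's `isBoundedVBComplex_hom₀_of_strictly ∕ _hom_twist_of_strictly`, (N3′) = this file's
`mapShiftedHom_phi_comp_routeK`. [cite: BuchweitzFlenner2003, §3–§4 and Def. 4.1] [cite: StacksProject, Tag 0BVH] -/
def tracePushforwardBricksRouteK (E : CochainComplex A.X.left.Modules ℤ) (a b : ℤ) [E.IsStrictlyGE a] [E.IsStrictlyLE b]
    (hE : ∀ i, IsFiniteLocallyFree (E.X i)) (hE' : ∀ i, IsFiniteLocallyFree ((endoPushforwardComplex A g E).X i)) (q : ℕ)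
    (αq : endoPushforwardComplex A g (twistHodgeComplex A.X q E) ≅ twistHodgeComplex A.X q (endoPushforwardComplex A g E))
    (Θ : endoPushforwardComplex A g (hodgeSingle A q) ⟶ hodgeSingle A q)
    (hT2 : kappaData A g E (twistHodgeComplex A.X q E) a b ≫ (homFunctor A.X.left (endoPushforwardComplex A g E)).map αq.hom ≫
        supertraceH A.X (endoPushforwardComplex A g E) hE' q =
      ((Scheme.Modules.pushforward (Hom.toSchemeHom g)).mapHomologicalComplex (ComplexShape.up ℤ)).map (supertraceH A.X E hE q) ≫ Θ) :
    letI := HasDerivedCategory.standard A.X.left.Modules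
    TracePushforwardBricks (isogenyDerivedAdjointPairOfRouteK A g hg) E a b hE hE' q αq :=
  tracePushforwardBricksOfResidual (isogenyDerivedAdjointPairOfRouteK A g hg) E a b hE hE' q αq Θ
    (isBoundedVBComplex_hom₀_of_strictly E a b hE) (isBoundedVBComplex_hom_twist_of_strictly E a b hE q) hT2
    (mapShiftedHom_phi_comp_routeK hg E a b hE hE' q _ _)

variable
  (α : ∀ (A : AbelianVariety ℂ) (g : A ⟶ A), IsIsogeny g → IsogenyTwistPushforwardIso A g)
  (Θ : ∀ (A : AbelianVariety ℂ) (g : A ⟶ A), IsIsogeny g → ∀ q : ℕ, endoPushforwardComplex A g (hodgeSingle A q) ⟶ hodgeSingle A q)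

/-- **(Tr)Pair FOR `P₀` FROM THE TWO REMAINING INPUTS**: a trace family `Θ` satisfying (T2•) for the data of record
`κ = homComplexPushforwardComparison` and `α`, and the injectivity of the Gysin maps `ρ_q = [Q η] · g_{**}(–) · [Q Θ_q]` — (T1•),
(N3′) and the `𝓗om•`-boundedness being theorems now (core-w2's `tracePushforwardCompatPair_of` fed with `tracePushforwardBricksRouteK`).
CONDITIONAL on exactly these two displayed hypotheses; closes no stub; HC_CM untouched. [cite: BuchweitzFlenner2003, §3–§4 and Def. 4.1]
[cite: StacksProject, Tag 0BVH] [cite: MumfordAV1970, §7 Thm. 4 (p. 72)] -/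
theorem tracePushforwardCompatPair_routeK_of_residual
    (hT2 : ∀ (A : AbelianVariety ℂ) (g : A ⟶ A) (hg : IsIsogeny g) (E : CochainComplex A.X.left.Modules ℤ) (a b : ℤ)
      [E.IsStrictlyGE a] [E.IsStrictlyLE b] (hE : ∀ i, IsFiniteLocallyFree (E.X i))
      (hE' : ∀ i, IsFiniteLocallyFree ((endoPushforwardComplex A g E).X i)) (q : ℕ),
      kappaData A g E (twistHodgeComplex A.X q E) a b ≫
          (homFunctor A.X.left (endoPushforwardComplex A g E)).map (α A g hg q E hE).hom ≫
            supertraceH A.X (endoPushforwardComplex A g E) hE' q =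
        ((Scheme.Modules.pushforward (Hom.toSchemeHom g)).mapHomologicalComplex (ComplexShape.up ℤ)).map (supertraceH A.X E hE q) ≫
          Θ A g hg q)
    (hρ : ∀ (A : AbelianVariety ℂ) (g : A ⟶ A) (hg : IsIsogeny g) (E : CochainComplex A.X.left.Modules ℤ) (a b : ℤ)
      [E.IsStrictlyGE a] [E.IsStrictlyLE b] (hE : ∀ i, IsFiniteLocallyFree (E.X i))
      (hE' : ∀ i, IsFiniteLocallyFree ((endoPushforwardComplex A g E).X i)) (q : ℕ),
      letI := HasDerivedCategory.standard A.X.left.Modules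
      Function.Injective (tracePushforwardBricksRouteK hg E a b hE hE' q (α A g hg q E hE) (Θ A g hg q)
        (hT2 A g hg E a b hE hE' q)).rho) :
    TracePushforwardCompatPair isogenyDerivedAdjointPairOfRouteK α :=
  tracePushforwardCompatPair_of isogenyDerivedAdjointPairOfRouteK α
    (fun A g hg E a b _ _ hE hE' q => tracePushforwardBricksRouteK hg E a b hE hE' q (α A g hg q E hE) (Θ A g hg q)
      (hT2 A g hg E a b hE hE' q))
    (fun A g hg E a b _ _ hE hE' q => hρ A g hg E a b hE hE' q)

end Residual

end Summit.HodgeConjecture.HodgeConjecture.Ring2.SemiregularRepresentatives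

end
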